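/-
Copyright (c) 2026. All rights reserved.
Released under Apache 2.0 license as described in the file LICENSE.
Authors: abc-iut cell, prover seat abc-iut-f-167 (block F, gen 5).
-/
import Literature.IUT.LogVolume.UnitLogWildDepth
import HarnessLib

/-!
# Depth of the log-unit lattice along a wildly ramified extension, II: the TIE case `e(K) = pᵃ(p−1)`

Proof-only sequel (theorems, no definitions) of `UnitLogWildDepth.lean` (depth inequality «for every
`z ∈ log_p(𝒪_K^×)` some `z' ∈ log_p(𝒪_{K'}^×)` has `‖z'‖ ≥ pᵗ·‖z‖» when `e(K') = e(K)·c·pᵗ` and `e(K)` is tie-free).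
HERE `e(K) = pᵃ(p−1)`: the exponents `c·n − e'·v_p(n)` of `L(1 − x)`, `x = w·ϖ'ᶜ` (`w` a unit of `K'`), attain
their minimum `N₀' = c·p^{a+t} − e'·(a+t)` at the TWO indices `p^{a+t}`, `p^{a+t+1}` (all others exceed it by
`≥ 1`), and the two tied terms sum to `−(x^{p^{a+t}}/p^{a+t})·(1 + x^{p^{a+t}(p−1)}/p)` with
`x^{p^{a+t}(p−1)} = w^{p^{a+t}(p−1)}·ϖ'^{e'}` of the norm of `p`; the sum keeps the norm `‖ϖ'‖^{N₀'}` exactly when the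
RESIDUE TEST `‖1 + x^{p^{a+t}(p−1)}/p‖ = 1` holds — arrangeable by a choice of `w` unless `K'` is of cyclotomic
type (residue field `𝔽_p` and `ϖ'^{e'}/p ≡ −1`), treated in `UnitLogWildDepthCyclotomic.lean`.  PROVED:

* `exponent_min_tie` — `E = S·P^{a₀}·(P−1)`, `S·Pᵃ(P−1) < E` below `a₀` ⇒ `h(a₀+1) = h(a₀)` and
  `h(a) ≥ h(a₀) + 1` for every other `a` (`h(a) = S·Pᵃ − E·a`);
* `norm_logSeries_eq_zpow_of_dominant_pair` — ultrametric read-out with TWO dominant terms summing to norm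
  `‖ϖ‖^{N₀}`, all other terms of exponent `≥ N₀ + 1` ⇒ `‖L(y)‖ = ‖ϖ‖^{N₀}`;
* `norm_logSeries_one_sub_of_tie` — `‖L(1 − w·ϖ'ᶜ)‖ = ‖ϖ'‖^{c·p^{a+t} − e'·(a+t)}` for `e(K') = pᵃ(p−1)·c·pᵗ`
  under the residue test;
* **`exists_mem_logUnits_pow_mul_norm_le_of_tie`** — `e(K) = pᵃ(p−1)`, `e(K') = e(K)·c·pᵗ`, a unit `w` of `K'`
  passing the residue test ⇒ **`pᵗ·‖z‖ ≤ ‖log_p(1 − w·ϖ'ᶜ)‖` for every `z ∈ log_p(𝒪_K^×)`**;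
Classical (Neukirch, *Algebraic Number Theory* II (5.5)); nothing here is disputed mathematics; no IUT statement
is asserted; nothing bears on [IUTchIII] Cor. 3.12.  Consumer: `TensorPacketSemilinearTransport(Wild).lean`
(item (X) of the G1-Θ memo at tie factors).
-/

noncomputable section

open Metric Set

namespace Literature.IUT.LogVolume

namespace RamificationCriterion

open Literature.NumberTheory.GaloisRepresentations.Ultrametric

/-! ### §1. The exponents in the tie case -/

section Exponents

variable {S P E : ℤ} {a₀ : ℕ}

/-- **Tie bookkeeping**: if `S·Pᵃ(P−1) < E` for `a < a₀` and `E = S·P^{a₀}·(P−1)` (`S ≥ 1`, `P ≥ 2`), then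
`h(a₀ + 1) = h(a₀)` and `h(a₀) + 1 ≤ h(a)` for every `a ∉ {a₀, a₀+1}`, `h(a) = S·Pᵃ − E·a`.
[cite: NeukirchANT1999, Ch. II (5.5)] -/
theorem exponent_min_tie (hS : 1 ≤ S) (hP : 2 ≤ P) (hlo : ∀ a < a₀, S * P ^ a * (P - 1) < E)
    (heq : E = S * P ^ a₀ * (P - 1)) :
    S * P ^ (a₀ + 1) - E * ((a₀ + 1 : ℕ) : ℤ) = S * P ^ a₀ - E * (a₀ : ℤ) ∧
      ∀ a : ℕ, a ≠ a₀ → a ≠ a₀ + 1 → S * P ^ a₀ - E * (a₀ : ℤ) + 1 ≤ S * P ^ a - E * (a : ℤ) := by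
  have htie : S * P ^ (a₀ + 1) - E * ((a₀ + 1 : ℕ) : ℤ) = S * P ^ a₀ - E * (a₀ : ℤ) := by
    have hid := exponent_succ_sub S P E a₀
    push_cast at hid ⊢
    linarith
  refine ⟨htie, fun a ha ha1 ↦ ?_⟩
  rcases lt_or_gt_of_ne ha with hlt | hgt
  · obtain ⟨d, rfl⟩ := Nat.exists_eq_add_of_lt hlt
    have h := exponent_add_le hlo (d + 1) a rfl
    push_cast at h ⊢
    linarith
  · -- `a ≥ a₀ + 2`: `h(a) ≥ h(a₀ + 2) = h(a₀ + 1) + E·(P − 1) ≥ h(a₀) + 1`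
    obtain ⟨d, rfl⟩ : ∃ d, a = a₀ + 1 + d + 1 := ⟨a - (a₀ + 2), by omega⟩
    have hPa : (0 : ℤ) ≤ P ^ a₀ := by positivity
    have h0 : 0 ≤ S * P ^ a₀ * (P - 1) := mul_nonneg (mul_nonneg (by linarith) hPa) (by linarith)
    have hhi' : E ≤ S * P ^ (a₀ + 1) * (P - 1) := by
      rw [heq, pow_succ]
      have hmono : S * P ^ a₀ * (P - 1) * 1 ≤ S * P ^ a₀ * (P - 1) * P :=
        mul_le_mul_of_nonneg_left (by linarith) h0
      have h2 : S * (P ^ a₀ * P) * (P - 1) = S * P ^ a₀ * (P - 1) * P := by ring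
      rw [h2]; linarith
    have hrest := exponent_succ_le_add (a₀ := a₀ + 1) hS hP hhi' d
    have hstep : S * P ^ a₀ - E * (a₀ : ℤ) + 1 ≤ S * P ^ (a₀ + 1 + 1) - E * ((a₀ + 1 + 1 : ℕ) : ℤ) := by
      have hid := exponent_succ_sub S P E (a₀ + 1)
      have h1 : (1 : ℤ) ≤ P ^ a₀ := one_le_pow₀ (by linarith)
      have hE1 : 1 ≤ E := by
        rw [heq]
        exact one_le_mul_of_one_le_of_one_le (one_le_mul_of_one_le_of_one_le hS h1) (by linarith)
      have hinc : E * (P - 1) ≤ S * P ^ (a₀ + 1) * (P - 1) - E := by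
        rw [heq, pow_succ]; apply le_of_eq; ring
      have hE2 : 1 ≤ E * (P - 1) := one_le_mul_of_one_le_of_one_le hE1 (by linarith)
      push_cast at hid htie ⊢
      linarith
    exact hstep.trans hrest

end Exponents

/-! ### §2. Two dominant terms -/

section Pair

variable (p : ℕ) [hp : Fact p.Prime]
variable {K : Type*} [NontriviallyNormedField K] [instK : NormedAlgebra ℚ_[p] K] [IsUltrametricDist K]
  [ProperSpace K]
variable {ϖ : Kˣ}

/-- **Two dominant terms decide the norm**: if the terms of indices `n₁ + 1 ≠ n₂ + 1` have exponent `N₀`, every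
other term has exponent `≥ N₀ + 1`, and the two dominant terms sum to norm `‖ϖ‖^{N₀}`, then `‖L(y)‖ = ‖ϖ‖^{N₀}`
(ultrametric isosceles principle). [cite: NeukirchANT1999, Ch. II (5.5)] -/
theorem norm_logSeries_eq_zpow_of_dominant_pair (hϖ : IsUniformizer ϖ) {y : K} (hyP : IsPrincipal y)
    {s : ℤ} (hy : ‖1 - y‖ = ‖(ϖ : K)‖ ^ s) {n₁ n₂ : ℕ} (hne : n₁ ≠ n₂) {N₀ : ℤ}
    (hpair : ‖-((1 - y) ^ (n₁ + 1)) / (n₁ + 1 : K) + -((1 - y) ^ (n₂ + 1)) / (n₂ + 1 : K)‖ = ‖(ϖ : K)‖ ^ N₀)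
    (h : ∀ n : ℕ, n ≠ n₁ → n ≠ n₂ →
      N₀ + 1 ≤ s * ((n + 1 : ℕ) : ℤ) - (absRamificationIdx p K : ℤ) * (padicValNat p (n + 1) : ℤ)) :
    ‖logSeries y‖ = ‖(ϖ : K)‖ ^ N₀ := by
  classical
  have hρ0 : 0 < ‖(ϖ : K)‖ := norm_units_pos ϖ
  set f : ℕ → K := fun n ↦ -((1 - y) ^ (n + 1)) / (n + 1 : K) with hf
  have hsum : HasSum f (logSeries y) := hasSum_logSeries p hyP
  have hsum' : HasSum (fun n ↦ if n = n₂ then 0 else (if n = n₁ then 0 else f n))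
      (logSeries y - f n₁ - (if n₂ = n₁ then 0 else f n₂)) :=
    hasSum_ite_sub_hasSum (hasSum_ite_sub_hasSum hsum n₁) n₂
  rw [if_neg hne.symm] at hsum'
  have hterm : ∀ n, ‖f n‖ = ‖(ϖ : K)‖ ^
      (s * ((n + 1 : ℕ) : ℤ) - (absRamificationIdx p K : ℤ) * (padicValNat p (n + 1) : ℤ)) :=
    fun n ↦ norm_logTerm_eq_zpow p hϖ hy n
  have hmain : ‖f n₁ + f n₂‖ = ‖(ϖ : K)‖ ^ N₀ := hpair
  have hrest : ‖logSeries y - f n₁ - f n₂‖ ≤ ‖(ϖ : K)‖ ^ (N₀ + 1) := by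
    rw [← hsum'.tsum_eq]
    refine IsUltrametricDist.norm_tsum_le_of_forall_le_of_nonneg (zpow_pos hρ0 _).le fun n ↦ ?_
    by_cases hn2 : n = n₂
    · rw [if_pos hn2, norm_zero]; exact (zpow_pos hρ0 _).le
    by_cases hn1 : n = n₁
    · rw [if_neg hn2, if_pos hn1, norm_zero]; exact (zpow_pos hρ0 _).le
    · rw [if_neg hn2, if_neg hn1, hterm n]
      exact zpow_le_zpow_right_of_le_one₀ hρ0 hϖ.1.le (h n hn1 hn2)
  have hlt : ‖logSeries y - f n₁ - f n₂‖ < ‖f n₁ + f n₂‖ := by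
    rw [hmain]
    exact hrest.trans_lt (zpow_lt_zpow_right_of_lt_one₀ hρ0 hϖ.1 (lt_add_one N₀))
  have hsplit : logSeries y = (f n₁ + f n₂) + (logSeries y - f n₁ - f n₂) := by ring
  rw [hsplit, IsUltrametricDist.norm_add_eq_max_of_norm_ne_norm (ne_of_gt hlt), max_eq_left hlt.le, hmain]

end Pair

/-! ### §3. `L(1 − w·ϖ'ᶜ)` in the tie case under the residue test -/

section Tie

variable (p : ℕ) [hp : Fact p.Prime]
variable {K : Type*} [NontriviallyNormedField K] [instK : NormedAlgebra ℚ_[p] K] [IsUltrametricDist K]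
  [ProperSpace K]
variable {K' : Type*} [NontriviallyNormedField K'] [instK' : NormedAlgebra ℚ_[p] K'] [IsUltrametricDist K']
  [ProperSpace K']

/-- **`‖L(1 − w·ϖ'ᶜ)‖ = ‖ϖ'‖^{c·p^{a+t} − e'·(a+t)}` in the tie case under the residue test**: `e' = e(K') =
pᵃ(p−1)·c·pᵗ`, `c ≥ 1`, `w` a unit of `K'` with `‖1 + (w ϖ'ᶜ)^{p^{a+t}(p−1)}/p‖ = 1`.  The exponents
`c·n − e'·v_p(n)` tie at the indices `p^{a+t}`, `p^{a+t+1}` (`exponent_min_tie` with the turning point `a + t`)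
and the two tied terms sum to `−(x^{p^{a+t}}/p^{a+t})·(1 + x^{p^{a+t}(p−1)}/p)`. [cite: NeukirchANT1999, Ch. II (5.5)] -/
theorem norm_logSeries_one_sub_of_tie {ϖ' : K'ˣ} (hϖ' : IsUniformizer ϖ') {a c t : ℕ} (hc : c ≠ 0)
    (he' : absRamificationIdx p K' = p ^ a * (p - 1) * (c * p ^ t)) {w : K'} (hw : ‖w‖ = 1)
    (hres : ‖1 + (w * (ϖ' : K') ^ c) ^ (p ^ (a + t) * (p - 1)) / (p : K')‖ = 1) :
    ‖logSeries (1 - w * (ϖ' : K') ^ c)‖ =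
      ‖(ϖ' : K')‖ ^ ((c : ℤ) * (p : ℤ) ^ (a + t) - (absRamificationIdx p K' : ℤ) * ((a + t : ℕ) : ℤ)) := by
  classical
  have hρ0 : 0 < ‖(ϖ' : K')‖ := norm_units_pos ϖ'
  set e' : ℕ := absRamificationIdx p K' with he'_def
  have hP : (2 : ℤ) ≤ (p : ℤ) := by exact_mod_cast hp.out.two_le
  have hc1 : (1 : ℤ) ≤ (c : ℤ) := by exact_mod_cast Nat.one_le_iff_ne_zero.mpr hc
  have hp1 : 1 + (p - 1) = p := by have := hp.out.one_le; omega
  -- `e' = c · p^{a+t} · (p − 1)` as an integer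
  have he'Z : (e' : ℤ) = (c : ℤ) * (p : ℤ) ^ (a + t) * ((p : ℤ) - 1) := by
    have h1 : ((p - 1 : ℕ) : ℤ) = (p : ℤ) - 1 := by rw [Nat.cast_sub hp.out.one_le]; push_cast; ring
    have h2 : (e' : ℤ) = ((p ^ a * (p - 1) * (c * p ^ t) : ℕ) : ℤ) := by exact_mod_cast he'
    rw [h2, Nat.cast_mul, Nat.cast_mul, Nat.cast_mul, Nat.cast_pow, Nat.cast_pow, h1]; ring
  -- the principal unit `y = 1 − x`, `x = w ϖ'^c`, `‖x‖ = ‖ϖ'‖^c`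
  set x : K' := w * (ϖ' : K') ^ c with hx_def
  set y : K' := 1 - x with hy_def
  have hxy : 1 - y = x := by rw [hy_def, sub_sub_cancel]
  have hy : ‖1 - y‖ = ‖(ϖ' : K')‖ ^ (c : ℤ) := by
    rw [hxy, hx_def, norm_mul, hw, one_mul, norm_pow, zpow_natCast]
  have hyP : IsPrincipal y := by
    rw [isPrincipal_iff, hy, zpow_natCast]
    exact pow_lt_one₀ (norm_nonneg _) hϖ'.1 hc
  -- turning point `a + t` with a tie
  have hlo' : ∀ b < a + t, (c : ℤ) * (p : ℤ) ^ b * ((p : ℤ) - 1) < e' := by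
    intro b hb
    rw [he'Z]
    have h1 : (p : ℤ) ^ b * ((p : ℤ) - 1) < (p : ℤ) ^ (a + t) * ((p : ℤ) - 1) := by
      have : (p : ℤ) ^ b < (p : ℤ) ^ (a + t) := pow_lt_pow_right₀ (by linarith) hb
      nlinarith
    have h2 : (c : ℤ) * (p : ℤ) ^ b * ((p : ℤ) - 1) = (c : ℤ) * ((p : ℤ) ^ b * ((p : ℤ) - 1)) := by ring
    have h3 : (c : ℤ) * (p : ℤ) ^ (a + t) * ((p : ℤ) - 1) = (c : ℤ) * ((p : ℤ) ^ (a + t) * ((p : ℤ) - 1)) := by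
      ring
    rw [h2, h3]
    exact mul_lt_mul_of_pos_left h1 (by linarith)
  obtain ⟨htie, hstrict⟩ := exponent_min_tie (a₀ := a + t) hc1 hP hlo' he'Z
  -- the two dominant indices
  obtain ⟨n₁, hn₁⟩ : ∃ n₁ : ℕ, n₁ + 1 = p ^ (a + t) :=
    ⟨p ^ (a + t) - 1, Nat.sub_add_cancel (Nat.one_le_pow _ _ hp.out.pos)⟩
  obtain ⟨n₂, hn₂⟩ : ∃ n₂ : ℕ, n₂ + 1 = p ^ (a + t + 1) :=
    ⟨p ^ (a + t + 1) - 1, Nat.sub_add_cancel (Nat.one_le_pow _ _ hp.out.pos)⟩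
  have hne : n₁ ≠ n₂ := by
    intro h
    have : p ^ (a + t) = p ^ (a + t + 1) := by rw [← hn₁, ← hn₂, h]
    exact absurd (Nat.pow_right_injective hp.out.two_le this) (by omega)
  set N₀ : ℤ := (c : ℤ) * (p : ℤ) ^ (a + t) - e' * ((a + t : ℕ) : ℤ) with hN₀_def
  have hN₁ : (c : ℤ) * ((n₁ + 1 : ℕ) : ℤ) - (e' : ℤ) * (padicValNat p (n₁ + 1) : ℤ) = N₀ := by
    rw [hN₀_def, hn₁, padicValNat.prime_pow]; push_cast; ring
  have hN₂ : (c : ℤ) * ((n₂ + 1 : ℕ) : ℤ) - (e' : ℤ) * (padicValNat p (n₂ + 1) : ℤ) = N₀ := by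
    rw [← htie, hn₂, padicValNat.prime_pow]; push_cast; ring
  have hdom : ∀ n : ℕ, n ≠ n₁ → n ≠ n₂ →
      N₀ + 1 ≤ (c : ℤ) * ((n + 1 : ℕ) : ℤ) - (e' : ℤ) * (padicValNat p (n + 1) : ℤ) := by
    intro n hn1 hn2
    obtain ⟨b, hb, hb'⟩ := exists_exponent_le_index (p := p) hc1 e' (Nat.succ_ne_zero n)
    by_cases hb1 : b = a + t
    · have hne' : n + 1 ≠ p ^ b := by rw [hb1, ← hn₁]; intro h; exact hn1 (by omega)
      have := hb' hne'
      rw [hb1] at this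
      exact this
    by_cases hb2 : b = a + t + 1
    · have hne' : n + 1 ≠ p ^ b := by rw [hb2, ← hn₂]; intro h; exact hn2 (by omega)
      have := hb' hne'
      rw [hb2, htie] at this
      exact this
    · exact (hstrict b hb1 hb2).trans hb
  -- the two tied terms: `term n₂ = term n₁ · (x^{p^{a+t}(p−1)} / p)`
  haveI : CharZero K' := charZero_of_injective_algebraMap (algebraMap ℚ_[p] K').injective
  have hp0 : (p : K') ≠ 0 := Nat.cast_ne_zero.mpr hp.out.ne_zero
  have hpow : p ^ (a + t) + p ^ (a + t) * (p - 1) = p ^ (a + t + 1) := by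
    calc p ^ (a + t) + p ^ (a + t) * (p - 1) = p ^ (a + t) * (1 + (p - 1)) := by ring
      _ = p ^ (a + t + 1) := by rw [hp1, pow_succ]
  have hcast₁ : ((n₁ : K') + 1) = (p : K') ^ (a + t) := by
    have h := congrArg (fun m : ℕ => (m : K')) hn₁
    push_cast at h
    exact h
  have hcast₂ : ((n₂ : K') + 1) = (p : K') ^ (a + t + 1) := by
    have h := congrArg (fun m : ℕ => (m : K')) hn₂
    push_cast at h
    exact h
  have hrel : -((1 - y) ^ (n₂ + 1)) / (n₂ + 1 : K') =
      (-((1 - y) ^ (n₁ + 1)) / (n₁ + 1 : K')) * (x ^ (p ^ (a + t) * (p - 1)) / (p : K')) := by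
    rw [hxy, hn₁, hn₂, hcast₁, hcast₂, ← hpow, pow_add, pow_succ]
    field_simp
  have hpair : ‖-((1 - y) ^ (n₁ + 1)) / (n₁ + 1 : K') + -((1 - y) ^ (n₂ + 1)) / (n₂ + 1 : K')‖ =
      ‖(ϖ' : K')‖ ^ N₀ := by
    have hsum : -((1 - y) ^ (n₁ + 1)) / (n₁ + 1 : K') + -((1 - y) ^ (n₂ + 1)) / (n₂ + 1 : K') =
        (-((1 - y) ^ (n₁ + 1)) / (n₁ + 1 : K')) * (1 + x ^ (p ^ (a + t) * (p - 1)) / (p : K')) := by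
      rw [hrel]; ring
    rw [hsum, norm_mul, hres, mul_one, norm_logTerm_eq_zpow p hϖ' hy n₁, hN₁]
  have h := norm_logSeries_eq_zpow_of_dominant_pair p hϖ' hyP hy hne hpair hdom
  rw [hN₀_def] at h
  exact h

/-- **Depth of the log-unit lattice in the tie case of non-cyclotomic type**: if `e(K) = pᵃ(p−1)`,
`e(K') = e(K)·c·pᵗ` with `c ≥ 1`, and some unit `w` of `K'` passes the residue test
`‖1 + (w ϖ'ᶜ)^{p^{a+t}(p−1)}/p‖ = 1` (for some norm uniformizer `ϖ'`), then for every `z ∈ log_p(𝒪_K^×)` there is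
`z' ∈ log_p(𝒪_{K'}^×)` — namely `log_p(1 − w ϖ'ᶜ)` — with **`pᵗ·‖z‖ ≤ ‖z'‖`**.
[cite: NeukirchANT1999, Ch. II (5.5)] [cite: Mochizuki2012, IUTchIV Prop. 1.2 (i) p. 10] -/
theorem exists_mem_logUnits_pow_mul_norm_le_of_tie {a c t : ℕ} (hea : absRamificationIdx p K = p ^ a * (p - 1))
    (hc : c ≠ 0) (he' : absRamificationIdx p K' = absRamificationIdx p K * (c * p ^ t))
    {ϖ' : K'ˣ} (hϖ' : IsUniformizer ϖ') {w : K'} (hw : ‖w‖ = 1)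
    (hres : ‖1 + (w * (ϖ' : K') ^ c) ^ (p ^ (a + t) * (p - 1)) / (p : K')‖ = 1)
    {z : K} (hz : z ∈ logUnits K) :
    ∃ z' ∈ logUnits K', (p : ℝ) ^ t * ‖z‖ ≤ ‖z'‖ := by
  classical
  obtain ⟨ϖ, hϖ⟩ := exists_isUniformizer (F := K)
  set e : ℕ := absRamificationIdx p K with he_def
  set e' : ℕ := absRamificationIdx p K' with he'_def
  have hp0 : (0 : ℝ) < p := by exact_mod_cast hp.out.pos
  have hP : (2 : ℤ) ≤ (p : ℤ) := by exact_mod_cast hp.out.two_le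
  -- `a` is the turning point of `h(b) = p^b − e·b`, with a tie
  have heZ : (e : ℤ) = 1 * (p : ℤ) ^ a * ((p : ℤ) - 1) := by
    have h1 : ((p - 1 : ℕ) : ℤ) = (p : ℤ) - 1 := by rw [Nat.cast_sub hp.out.one_le]; push_cast; ring
    rw [hea]; push_cast; rw [h1]; ring
  have hlo : ∀ b < a, (1 : ℤ) * (p : ℤ) ^ b * ((p : ℤ) - 1) < e := by
    intro b hb
    rw [heZ]
    have : (p : ℤ) ^ b < (p : ℤ) ^ a := pow_lt_pow_right₀ (by linarith) hb
    nlinarith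
  have hz' := norm_le_zpow_of_mem_logUnits p hϖ hlo heZ.le hz
  rw [norm_unif_zpow_eq_rpow p hϖ] at hz'
  -- the witness
  set y : K' := 1 - w * (ϖ' : K') ^ c with hy_def
  have hyP : IsPrincipal y := by
    rw [isPrincipal_iff, hy_def, sub_sub_cancel, norm_mul, hw, one_mul, norm_pow]
    exact pow_lt_one₀ (norm_nonneg _) hϖ'.1 hc
  have he'' : absRamificationIdx p K' = p ^ a * (p - 1) * (c * p ^ t) := by rw [← he'_def, he', hea]
  refine ⟨unitLog y, unitLog_mem_logUnits hyP.norm_eq_one, ?_⟩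
  rw [unitLog_of_isPrincipal p hyP, norm_logSeries_one_sub_of_tie p hϖ' hc he'' hw hres,
    norm_unif_zpow_eq_rpow p hϖ']
  -- compare the exponents (same computation as in the tie-free case)
  have heR : (e : ℝ) ≠ 0 := by exact_mod_cast (absRamificationIdx_pos p K).ne'
  have hcR : (c : ℝ) ≠ 0 := by exact_mod_cast hc
  have hptR : (p : ℝ) ^ t ≠ 0 := pow_ne_zero _ hp0.ne'
  have he'R : (e' : ℝ) = e * (c * (p : ℝ) ^ t) := by exact_mod_cast he'
  have hexp : (t : ℝ) + -(((1 : ℤ) * (p : ℤ) ^ a - (e : ℤ) * (a : ℤ) : ℤ) : ℝ) / (e : ℝ) =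
      -(((c : ℤ) * (p : ℤ) ^ (a + t) - (e' : ℤ) * ((a + t : ℕ) : ℤ) : ℤ) : ℝ) / (e' : ℝ) := by
    push_cast
    rw [he'R]
    field_simp
    ring
  calc (p : ℝ) ^ t * ‖z‖
      ≤ (p : ℝ) ^ t * (p : ℝ) ^ (-(((1 : ℤ) * (p : ℤ) ^ a - (e : ℤ) * (a : ℤ) : ℤ) : ℝ) / (e : ℝ)) :=
        mul_le_mul_of_nonneg_left hz' (pow_pos hp0 _).le
    _ = (p : ℝ) ^ ((t : ℝ) + -(((1 : ℤ) * (p : ℤ) ^ a - (e : ℤ) * (a : ℤ) : ℤ) : ℝ) / (e : ℝ)) := by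
        rw [Real.rpow_add hp0, Real.rpow_natCast]
    _ = (p : ℝ) ^ (-(((c : ℤ) * (p : ℤ) ^ (a + t) - (e' : ℤ) * ((a + t : ℕ) : ℤ) : ℤ) : ℝ) / (e' : ℝ)) := by
        rw [hexp]

end Tie

end RamificationCriterion

end Literature.IUT.LogVolume

end
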